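import Literature.NumberTheory.LFunctions.RealZeroEffectiveRepulsionExplicit
import HarnessLib

/-!
# The Siegel–Tatuzawa–Hoffstein theorem with explicit constants (Chen 2007): with at most one
# exception, `L(1,χ) > min{1/(7.732 log k), 1.5·10⁶ ε/k^ε}` for real primitive `χ` mod `k > e^{1/ε}`

Topic `Literature/NumberTheory/LFunctions` (namespace `Literature.NumberTheory.LFunctions`; the
paper's bound in the sub-namespace `Chen2007STH`). STATEMENT LAYER for the cell `parity-realchar`
(SIEGEL INSTRUMENT; TARGET.md §2 comparator «printed effective `L(1)` floors with one exception» —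
the theory seat's call, CONDITIONALS 18:45Z (g): "revisit as TARGET comparators only if idle"). ONE
named fact and PROVED readings on the column's predicate `IsSiegelZero`.

Source: Yong-Gao Chen, *On the Siegel–Tatuzawa–Hoffstein theorem*, Acta Arith. 130 (2007) 361–367
[Chen2007SiegelTatuzawaHoffstein] (held: `paper:doi-10-4064-aa130-4-5`, p. 361), verbatim:
"**Theorem 1.** Let `0 < ε < 1/(6 log 10)` and `χ` be a real primitive Dirichlet character modulo
`k` with `k > e^{1/ε}`. Then, with at most one exception,
`L(1, χ) > min{1/(7.732 log k), 1.5·10⁶ ε/k^ε}`." The same page restates the predecessors: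
Tatuzawa 1951 ("if `0 < ε < 1/11.2` and `k > e^{1/ε}`, then, with at most one exception,
`L(1,χ) > 0.655 ε/k^ε`"), Hoffstein 1980 (`min{1/(7.735 log k), ε/(0.349 k^ε)}`) and Ji–Lu 2004
(`min{1/(7.7388 log k), 32.260 ε/k^ε}` [JiLu2004LOneLowerBound]; NOTE: Ji–Lu's own statement,
Acta Arith. 111 (2004) p. 405, held, has the threshold "`k` greater than `10⁶`", while Chen restates
it with `k > e^{1/ε}` — only Chen's Theorem 1 is typed here, exactly as printed). The tree PROVES
Tatuzawa's theorem with a weak explicit constant (`tatuzawa`, `TatuzawaTheorem.lean`: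
`C_T ε³ q^{−ε}`); this file records the printed record constants as a named fact — PROVED since
(2026-08-28): `chen2007_theorem1_holds`, `SiegelTatuzawaChenTheoremOne.lean`.

## How it is typed

* `Chen2007STH.bound ε k = min (1/(7.732 log k)) (1.5·10⁶ ε/k^ε)`.
* `chen2007_theorem1` — NAMED FACT. "With at most one exception" (for each `ε`) is rendered
  pairwise, as for `basakThornerZaharescu2026_theorem11`: two real (quadratic) primitive characters
  that are distinct — (a) different moduli `k₁ ≠ k₂`, or (b) the same modulus and `χ₁ ≠ χ₂` — both
  with `k > e^{1/ε}`, cannot BOTH violate the bound; `L(1,χ)` is rendered as `‖L(1,χ)‖` (for a real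
  character `L(1,χ)` is real and positive). The exception may depend on `ε` (the weaker reading).
* PROVED readings (with the tree's explicit Montgomery–Vaughan (11.10),
  `RealZeroRepulsion.isSiegelZero_eta_le`: a Siegel zero of quality `η` at `k ≥ 8` forces
  `‖L(1,χ)‖ ≤ 55 log k/η`): `IsSiegelZero.norm_LFunction_one_le'` (that inequality in the form used
  here) and **`IsSiegelZero.quality_le_or_of_chen2007`** — modulo the fact, for `0 < ε < 1/(6 log 10)`
  and two Siegel zeros at distinct primitive quadratic characters of conductors `k₁, k₂ > e^{1/ε}`,
  at least one has quality `ηᵢ ≤ 55 log kᵢ/bound ε kᵢ`: an EFFECTIVE «at most one Siegel zero of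
  quality `> 55 log k · max{7.732 log k, k^ε/(1.5·10⁶ ε)}`» — the zero-side form of the
  Siegel–Tatuzawa–Hoffstein theorem on the column's predicate.

LABEL (cell rule): instrument / statement layer + kernel reading. WHAT THIS IS NOT: ineffective for
the possible exceptional character (that is the point of Tatuzawa's theorem); no claim about which
character, if any, is exceptional; nothing here bears on the parity summit.

## References

* [Chen2007SiegelTatuzawaHoffstein] Y.-G. Chen, Acta Arith. 130 (2007) 361–367 — Theorem 1 (p. 361)
  and the restatements of Tatuzawa / Hoffstein / Ji–Lu on the same page.
* [JiLu2004LOneLowerBound] C.-G. Ji, H.-W. Lu, Acta Arith. 111 (2004) 405–409 — the Theorem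
  (p. 405–406; threshold `k > 10⁶` as printed there).
* [Tatuzawa1951] T. Tatuzawa, Japan. J. Math. 21 (1951) — tree: `tatuzawa` (PROVED, weak constant).
* [MontgomeryVaughan2007] Theorem 11.4 (11.10) — tree: `RealZeroRepulsion.isSiegelZero_eta_le`.
* [TaoTeravainen2021] Definition 1.4 (quality `η`).
-/

noncomputable section

open Literature.Barriers.Parity

namespace Literature.NumberTheory.LFunctions

namespace Chen2007STH

/-- Chen's lower bound `min{1/(7.732 log k), 1.5·10⁶ ε/k^ε}`.
[cite: Chen2007SiegelTatuzawaHoffstein, Theorem 1] -/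
def bound (ε : ℝ) (k : ℕ) : ℝ :=
  min (1 / (7.732 * Real.log k)) (1.5e6 * ε / (k : ℝ) ^ ε)

/-- The bound is positive for `k ≥ 2` and `ε > 0`. [cite: Chen2007SiegelTatuzawaHoffstein, Theorem 1] -/
theorem bound_pos {ε : ℝ} (hε : 0 < ε) {k : ℕ} (hk : 2 ≤ k) : 0 < bound ε k := by
  have hk1 : (1 : ℝ) < k := by exact_mod_cast (show 1 < k by omega)
  have hlog : 0 < Real.log k := Real.log_pos hk1
  have hkpow : 0 < (k : ℝ) ^ ε := Real.rpow_pos_of_pos (by linarith) ε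
  unfold bound
  exact lt_min (by positivity) (by positivity)

end Chen2007STH

open Chen2007STH

/-- **Chen 2007, Theorem 1 (NAMED FACT, as printed; "with at most one exception" rendered
pairwise, for each `ε`).** "Let `0 < ε < 1/(6 log 10)` and `χ` be a real primitive Dirichlet
character modulo `k` with `k > e^{1/ε}`. Then, with at most one exception,
`L(1, χ) > min{1/(7.732 log k), 1.5·10⁶ ε/k^ε}`." Rendered: for two primitive quadratic characters
`χ₁ mod k₁`, `χ₂ mod k₂`, both with `k > e^{1/ε}`, that are distinct — (a) `k₁ ≠ k₂`, or (b)
`k₁ = k₂` and `χ₁ ≠ χ₂` —, `‖L(1,χ₁)‖ > bound ε k₁` or `‖L(1,χ₂)‖ > bound ε k₂`.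
PROVED (2026-08-28): `chen2007_theorem1_holds` (`SiegelTatuzawaChenTheoremOne.lean`) — Chen's chain
pp. 362–366 (`r = 1/11.657`, `x = (k k₁)^{3/2}`, `c/2 ↦ 0.31`, `u = 19.6`, `v = 30`) on kernel inputs:
Hoffstein's Lemma 4 with `A = 3/2` (`Hoffstein1980.core3`, the Dedekind zeta of the biquadratic field as
the product of the three quadratic `L`-functions with `ζ`), McCurley 1984 Theorem 2
(`McCurley1984_theorem2_holds`) for Lemma 1, Louboutin's `½ log f + 1.3`
(`Louboutin2001.norm_LFunction_one_le_of_isPrimitive`) for Lemma 2; the hypothesis-free readings are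
`IsSiegelZero.quality_le_or_chen2007` and `SiegelTatuzawa.chen2007_atMostOneException_holds` there.
[cite: Chen2007SiegelTatuzawaHoffstein, Theorem 1 p. 361, proof pp. 362–366] -/
def chen2007_theorem1 : Prop :=
  ∀ ε : ℝ, 0 < ε → ε < 1 / (6 * Real.log 10) →
    (∀ (k₁ k₂ : ℕ) [NeZero k₁] [NeZero k₂] (χ₁ : DirichletCharacter ℂ k₁)
        (χ₂ : DirichletCharacter ℂ k₂), k₁ ≠ k₂ →
        Real.exp (1 / ε) < k₁ → Real.exp (1 / ε) < k₂ →
        χ₁.IsPrimitive → χ₁.IsQuadratic → χ₂.IsPrimitive → χ₂.IsQuadratic →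
          bound ε k₁ < ‖χ₁.LFunction 1‖ ∨ bound ε k₂ < ‖χ₂.LFunction 1‖) ∧
    (∀ (k : ℕ) [NeZero k] (χ₁ χ₂ : DirichletCharacter ℂ k), χ₁ ≠ χ₂ → Real.exp (1 / ε) < k →
        χ₁.IsPrimitive → χ₁.IsQuadratic → χ₂.IsPrimitive → χ₂.IsQuadratic →
          bound ε k < ‖χ₁.LFunction 1‖ ∨ bound ε k < ‖χ₂.LFunction 1‖)

/-! ### Readings on the column's predicate (PROVED modulo the named fact) -/

/-- `e^{1/ε} < k` with `ε < 1/(6 log 10)` forces `k ≥ 8` (indeed `k > 10⁶`): `1/ε > 6 log 10 ≥ 3`,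
so `k > e³ > 8`. [folklore] -/
private theorem eight_le_of_exp_lt {ε : ℝ} (hε : 0 < ε) (hε' : ε < 1 / (6 * Real.log 10)) {k : ℕ}
    (hk : Real.exp (1 / ε) < k) : 8 ≤ k := by
  have hlog10 : 2 < Real.log 10 := by
    have h : Real.log 2 ≤ Real.log 10 := Real.log_le_log (by norm_num) (by norm_num)
    have h8 : Real.log 8 = 3 * Real.log 2 := by
      rw [show (8 : ℝ) = 2 ^ 3 by norm_num, Real.log_pow]; norm_num
    have h2 : (0.6931471803 : ℝ) < Real.log 2 := Real.log_two_gt_d9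
    have h810 : Real.log 8 ≤ Real.log 10 := Real.log_le_log (by norm_num) (by norm_num)
    linarith
  have h6 : 0 < 6 * Real.log 10 := by positivity
  have hinv : 3 < 1 / ε := by
    rw [lt_div_iff₀ hε]
    have := (lt_div_iff₀ h6).mp hε'
    nlinarith
  have hexp3 : Real.exp 3 ≤ Real.exp (1 / ε) := Real.exp_le_exp.mpr hinv.le
  have he : (2.7182818283 : ℝ) < Real.exp 1 := Real.exp_one_gt_d9
  have hexp3' : (8 : ℝ) < Real.exp 3 := by
    have h3 : Real.exp 3 = Real.exp 1 ^ 3 := by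
      rw [Real.exp_one_pow 3]; norm_num
    have hcube : (2.7182818283 : ℝ) ^ 3 < Real.exp 1 ^ 3 :=
      pow_lt_pow_left₀ he (by norm_num) (by norm_num)
    rw [h3]
    linarith [show (8 : ℝ) < (2.7182818283 : ℝ) ^ 3 by norm_num]
  have : (8 : ℝ) < k := by linarith
  exact_mod_cast this.le

/-- A Siegel zero of quality `η` at a conductor `k ≥ 8` forces `‖L(1,χ)‖ ≤ 55 log k/η` (the tree's
explicit (11.10), `RealZeroRepulsion.isSiegelZero_eta_le`, divided by `log k`).
[cite: MontgomeryVaughan2007, Theorem 11.4 (11.10)] [cite: TaoTeravainen2021, Definition 1.4] -/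
theorem _root_.Literature.Barriers.Parity.IsSiegelZero.norm_LFunction_one_le' {k : ℕ} [NeZero k]
    (hk : 8 ≤ k) {χ : DirichletCharacter ℂ k} {η : ℝ} (hS : IsSiegelZero χ η) :
    ‖χ.LFunction 1‖ ≤ 55 * Real.log k / η := by
  have h := RealZeroRepulsion.isSiegelZero_eta_le hk hS
  have hk1 : (1 : ℝ) < k := by exact_mod_cast (show 1 < k by omega)
  have hlog : 0 < Real.log k := Real.log_pos hk1
  have hη : 0 < η := by linarith [hS.ten_le]
  rw [le_div_iff₀ hη]
  rw [le_div_iff₀ hη] at h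
  -- `‖L‖ log k · η ≤ 55 log² k` ⇒ `‖L‖ η ≤ 55 log k`
  have : ‖χ.LFunction 1‖ * η * Real.log k ≤ 55 * Real.log k * Real.log k := by nlinarith
  exact le_of_mul_le_mul_right this hlog

/-- **At most one Siegel zero of large quality beyond `e^{1/ε}`, effectively** (READING of Chen's
Theorem 1 modulo the named fact): for `0 < ε < 1/(6 log 10)` and Siegel zeros of qualities `η₁`,
`η₂` attached to DISTINCT primitive quadratic characters `χ₁ mod k₁`, `χ₂ mod k₂` (different moduli,
or the same modulus and `χ₁ ≠ χ₂`) with `k₁, k₂ > e^{1/ε}`, at least one quality is small: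
`η₁ ≤ 55 log k₁/bound ε k₁` or `η₂ ≤ 55 log k₂/bound ε k₂`
(`bound ε k = min{1/(7.732 log k), 1.5·10⁶ ε/k^ε}`; so the exceptional quality threshold is
`55 log k · max{7.732 log k, k^ε/(1.5·10⁶ ε)}`). [cite: Chen2007SiegelTatuzawaHoffstein, Theorem 1]
[cite: MontgomeryVaughan2007, Theorem 11.4 (11.10)] [cite: TaoTeravainen2021, Definition 1.4] -/
theorem _root_.Literature.Barriers.Parity.IsSiegelZero.quality_le_or_of_chen2007
    (h : chen2007_theorem1) {ε : ℝ} (hε : 0 < ε) (hε' : ε < 1 / (6 * Real.log 10))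
    {k₁ k₂ : ℕ} [NeZero k₁] [NeZero k₂] {χ₁ : DirichletCharacter ℂ k₁}
    {χ₂ : DirichletCharacter ℂ k₂} {η₁ η₂ : ℝ} (hS₁ : IsSiegelZero χ₁ η₁) (hS₂ : IsSiegelZero χ₂ η₂)
    (hdist : k₁ ≠ k₂ ∨ (∃ h : k₁ = k₂, h ▸ χ₁ ≠ χ₂))
    (hk₁ : Real.exp (1 / ε) < k₁) (hk₂ : Real.exp (1 / ε) < k₂) :
    η₁ ≤ 55 * Real.log k₁ / bound ε k₁ ∨ η₂ ≤ 55 * Real.log k₂ / bound ε k₂ := by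
  have hk₁8 : 8 ≤ k₁ := eight_le_of_exp_lt hε hε' hk₁
  have hk₂8 : 8 ≤ k₂ := eight_le_of_exp_lt hε hε' hk₂
  have hb₁ : 0 < bound ε k₁ := bound_pos hε (by omega)
  have hb₂ : 0 < bound ε k₂ := bound_pos hε (by omega)
  have hη₁ : 0 < η₁ := by linarith [hS₁.ten_le]
  have hη₂ : 0 < η₂ := by linarith [hS₂.ten_le]
  have hL₁ := hS₁.norm_LFunction_one_le' hk₁8
  have hL₂ := hS₂.norm_LFunction_one_le' hk₂8
  -- the printed alternative
  have halt : bound ε k₁ < ‖χ₁.LFunction 1‖ ∨ bound ε k₂ < ‖χ₂.LFunction 1‖ := by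
    obtain ⟨hA, hB⟩ := h ε hε hε'
    rcases hdist with hne | ⟨hkk, hχne⟩
    · exact hA k₁ k₂ χ₁ χ₂ hne hk₁ hk₂ hS₁.1 hS₁.2.1 hS₂.1 hS₂.2.1
    · subst hkk
      exact hB k₁ χ₁ χ₂ hχne hk₁ hS₁.1 hS₁.2.1 hS₂.1 hS₂.2.1
  -- if `bound < ‖L(1,χᵢ)‖ ≤ 55 log kᵢ/ηᵢ` then `ηᵢ < 55 log kᵢ/bound`
  rcases halt with h₁ | h₂
  · left
    have : bound ε k₁ < 55 * Real.log k₁ / η₁ := lt_of_lt_of_le h₁ hL₁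
    rw [lt_div_iff₀ hη₁] at this
    rw [le_div_iff₀ hb₁]
    linarith
  · right
    have : bound ε k₂ < 55 * Real.log k₂ / η₂ := lt_of_lt_of_le h₂ hL₂
    rw [lt_div_iff₀ hη₂] at this
    rw [le_div_iff₀ hb₂]
    linarith

end Literature.NumberTheory.LFunctions

end
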